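import Literature.NumberTheory.GelbartRogawski1991.UnitaryDualPairFaceSplitCoinvariants
import Literature.RepresentationTheory.TwistedCoinvariantsCompTransport
import HarnessLib

/-!
# The split of the `χ`-coinvariants followed by transport of the acting group: equivariance for a face action

Topic `NumberTheory/GelbartRogawski1991`; namespace `Literature.NumberTheory.GelbartRogawski1991.UnitaryDualPair` (PROOF sequel of
`UnitaryDualPairFaceSplitCoinvariants` — `splitCoinvEquiv`, `splitCoinvEquiv_mk` — and of
`RepresentationTheory/TwistedCoinvariantsCompTransport` — `TwistedCoinv.coinvTransportEquiv`).  ONE THEOREM, generic over a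
commutative ring `k` and ATOMIC representations; no definition, no named fact, no `sorry`.

WHY.  A consumer identifies the `χ`-coinvariants `Coinv ρW χ` of a big Weil-type module `S` with
`Coinv ((ρ₁ ⊗ ρ₂) ∘ e) χ′` in two steps — the split `splitCoinvEquiv` along `T : S₁ ⊗ S₂ ≃ S` ([Liu2021, proof of Thm. 4.15]:
`R_B(u ⊕ 1)` splits as `ω⋆ ⊗ ω⊥` up to the see-saw character `ξ`) and the transport of the acting group along an isomorphism
`e : H′ ≃* H` (`coinvTransportEquiv`) — and then needs the resulting `Φ` to intertwine a FACE action `(rep χ ρV) ∘ φ` of a third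
group `G` with `((σ₁ ∘ θ) ⊗ 1)` acting on `Coinv ((ρ₁ ∘ e) ⊗ (ρ₂ ∘ e)) χ′`.  The two spellings `(ρ₁ ⊗ ρ₂) ∘ e` and
`(ρ₁ ∘ e) ⊗ (ρ₂ ∘ e)` (and `(σ₁ ⊗ 1)(θ g)` vs `((σ₁ ∘ θ) ⊗ 1)(g)`) agree definitionally but not syntactically; at a concrete Weil
datum the identification cannot be rewritten inside the goal (the defeq check on the instantiated terms exceeds the default `whnf`
budget), so the statement is proved HERE once, over atoms and on representatives, with both spellings explicit, and instantiated by a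
single application downstream (the Hodge CM programme's GS-6 glue, node G2c).

## References
* [Liu2021] Y. Liu, *Fourier–Jacobi cycles and arithmetic relative trace formula*, Camb. J. Math. 9 (2021) = arXiv:2102.11518:
  proof of Thm. 4.15 (FJcycle.tex l. 2199–2210), App. D §D.1 Step 3 (l. 5221).
* [GelbartRogawski1991] S. Gelbart, J. Rogawski, Invent. Math. 105 (1991), §3.1 Prop. 3.1.1 p. 455, Remark p. 457 L4–13.
-/

noncomputable section

namespace Literature.NumberTheory.GelbartRogawski1991.UnitaryDualPair

open Literature.RepresentationTheory
open scoped TensorProduct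

/-- **the split-and-transport identification intertwines a face action with `(σ₁ ∘ θ) ⊗ 1`** (generic; atomic representations).
Data: `ρW` on `S` with its split `T : S₁ ⊗ S₂ ≃ S` over `ρ₁ ⊗ ρ₂` up to `ξ` (`hT`), a `G₀`-action `ρV` commuting with `ρW` (`hc`) and
transported by `T` to `σ₁ ⊗ 1` along `θ` over `φ` (`hV : ρV (φ g) (T x) = T ((σ₁ ⊗ 1) (θ g) x)`), a group isomorphism `e : H′ ≃* H`
with `χ′ = (χ ξ⁻¹) ∘ e`.  Then `Φ := splitCoinvEquiv ≫ (coinvTransportEquiv (ρ₁ ⊗ ρ₂) (χ ξ⁻¹) e χ′)⁻¹` satisfies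
`Φ ((rep χ ρV ∘ φ) g w) = rep χ′ ((σ₁ ∘ θ) ⊗ 1) g (Φ w)`, the right-hand `rep` formed over `(ρ₁ ∘ e) ⊗ (ρ₂ ∘ e)`.
[cite: Liu2021, proof of Thm. 4.15 (FJcycle.tex l. 2199–2210)] [cite: GelbartRogawski1991, §3.1 Remark p. 457 L4–13] -/
theorem splitCoinvEquiv_trans_coinvTransportEquiv_symm_rep_comp
    {k : Type*} [CommRing k] {G G₀ G₁ H H' S S₁ S₂ : Type*} [Group G] [Group G₀] [Group G₁] [Group H] [Group H']
    [AddCommGroup S] [Module k S] [AddCommGroup S₁] [Module k S₁] [AddCommGroup S₂] [Module k S₂]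
    (ρW : Representation k H S) (ρ₁ : Representation k H S₁) (ρ₂ : Representation k H S₂)
    (ρV : Representation k G₀ S) (σ₁ : Representation k G₁ S₁) (T : S₁ ⊗[k] S₂ ≃ₗ[k] S) (ξ χ : H →* kˣ)
    (hT : ∀ (u : H) (x : S₁ ⊗[k] S₂), ρW u (T x) = ((ξ u : kˣ) : k) • T ((ρ₁.tprod ρ₂) u x))
    (hc : ∀ (g : G₀) (h : H), Commute (ρV g) (ρW h)) (φ : G →* G₀) (θ : G →* G₁)
    (hV : ∀ (g : G) (x : S₁ ⊗[k] S₂), ρV (φ g) (T x) = T ((σ₁.tprod (1 : Representation k G₁ S₂)) (θ g) x))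
    (e : H' ≃* H) (χ' : H' →* kˣ) (hχ : ∀ h' : H', χ' h' = (χ * ξ⁻¹) (e h'))
    (hc₂ : ∀ (g : G) (h' : H'), Commute ((Representation.tprod (σ₁.comp θ) (1 : Representation k G S₂)) g)
      ((Representation.tprod (ρ₁.comp e.toMonoidHom) (ρ₂.comp e.toMonoidHom)) h'))
    (g : G) (w : TwistedCoinv.Coinv ρW χ) :
    ((splitCoinvEquiv ρW ρ₁ ρ₂ T ξ χ hT).trans
        (TwistedCoinv.coinvTransportEquiv (ρ₁.tprod ρ₂) (χ * ξ⁻¹) e χ' hχ).symm) (((TwistedCoinv.rep χ ρV hc).comp φ) g w) =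
      TwistedCoinv.rep χ' (Representation.tprod (σ₁.comp θ) (1 : Representation k G S₂)) hc₂ g
        (((splitCoinvEquiv ρW ρ₁ ρ₂ T ξ χ hT).trans
          (TwistedCoinv.coinvTransportEquiv (ρ₁.tprod ρ₂) (χ * ξ⁻¹) e χ' hχ).symm) w) := by
  obtain ⟨v, rfl⟩ := TwistedCoinv.mk_surjective ρW χ w
  obtain ⟨x, rfl⟩ := T.surjective v
  rw [MonoidHom.comp_apply, TwistedCoinv.rep_mk, hV, LinearEquiv.trans_apply, LinearEquiv.trans_apply, splitCoinvEquiv_mk,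
    splitCoinvEquiv_mk, TwistedCoinv.coinvTransportEquiv_symm_mk, TwistedCoinv.coinvTransportEquiv_symm_mk]
  -- the two `Coinv` spellings `(ρ₁ ⊗ ρ₂) ∘ e` ∕ `(ρ₁ ∘ e) ⊗ (ρ₂ ∘ e)` and `(σ₁ ⊗ 1)(θ g)` ∕ `((σ₁ ∘ θ) ⊗ 1)(g)` agree
  -- definitionally on atoms (`rw` cannot see it at instances transparency; `exact` can).
  exact (TwistedCoinv.rep_mk χ' _ hc₂ g x).symm

end Literature.NumberTheory.GelbartRogawski1991.UnitaryDualPair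

end
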